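import Mathlib
import HarnessLib
import Literature.NumberTheory.EllipticCurves.FramedTateGaloisRep
import Literature.NumberTheory.EllipticCurves.TateModule
import Literature.NumberTheory.EllipticCurves.GaloisAction
import Literature.NumberTheory.EllipticCurves.HasseWeilGoodReductionFrobenius
import Literature.NumberTheory.DiophantineGeometry.LocalReduction
import Literature.NumberTheory.GaloisRepresentations.GaloisRep
import Literature.NumberTheory.GaloisRepresentations.AbsGaloisGroup
import Literature.NumberTheory.GaloisRepresentations.LocalGaloisGroup
import Literature.NumberTheory.GaloisRepresentations.IntegralGaloisAction
import Literature.NumberTheory.GaloisRepresentations.OrdinaryGaloisRep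
import Literature.NumberTheory.GaloisRepresentations.ResidualRepresentation
import Literature.NumberTheory.GaloisRepresentations.StableLattice
import Literature.NumberTheory.Automorphic.AdicCompletionLocalField
import Summits.Langlands.Langlands.Theorems.EisensteinProModularSeed.Negative.OrientedFrame
import Summits.Langlands.Langlands.Theorems.SkinnerWilesDefectOneEisensteinProModularSeedLevelRaisedEisensteinNewformQGlue
import Summits.Langlands.Langlands.Theorems.SkinnerWilesDefectOneEisensteinProModularSeedCousinGaloisPackageAux
import Summits.Langlands.Langlands.Theorems.SkinnerWilesDefectOneEisensteinProModularSeedCousinGaloisPackageAux2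
import Literature.NumberTheory.EllipticCurves.OrdinaryReductionTateModule

/-!
# `EisensteinProModularSeed` (stmt-Langlands-12920), line `descend-raise-basechange` (skeleton v6):
# stub S7e `stub_cousinGaloisPackageWide` — the Galois side of the cousin graft for EVERY prime `p`
# (CONDITIONAL on the same two named facts as S7a)

This is the landed stub S7a `stub_cousinGaloisPackage` (file
`SkinnerWilesDefectOneEisensteinProModularSeedCousinGaloisPackage`) with the hypothesis `5 ≤ p` removed and
its two consequences at the places `v ∣ p` turned into hypotheses: the ramification bound
`e(v ∣ p) < p - 1` (Mathlib `Ideal.ramificationIdx`) and an element of the local inertia group `I_{F_v}`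
(`absInertia (v.adicCompletion F)`) on which the `p`-adic cyclotomic character is `≢ 1 (mod p)`
(`ω|_{I_v} ≠ 1`).  For `p ≥ 5` over a quadratic field both are automatic (S7a derives them from
`Cousin.ramificationIdx_le_finrank_rat` and `Cousin.exists_mem_absInertia_toZModPow_cyclotomicCharacter_ne_one`);
the present form also covers `p = 3` at places where `3` is unramified.

From a twist-free cousin `(E, P, Q, q)` of the residual datum `ρ₀ : Γ_F → GL₂(O)` over an imaginary
quadratic field `F` (`O = 𝒪_{ℚ̄_p}`; `P, Q ∈ E[p]`, `P ≠ 0`, `Q ∉ ℤP`, `σP = aP`, `σQ = bP + dQ` with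
`(ρ₀σ)₀₀ ≡ a`, `(ρ₀σ)₁₁ ≡ d`; at every `v ∣ p`: `P` inertia-fixed, `E` good, `e(v ∣ p) < p - 1` and
`ω|_{I_v} ≠ 1`; `E` good at every residually unramified `v ≠ q`, `v ∤ p`; `V_pE` irreducible) we build
`r = V_pE` framed on a `ℤ_p`-basis of `T_pE` lifting `(P, Q)` — a frame-conjugate of the tree's
`E.framedTateGaloisRep p` — IRREDUCIBLE, with an integral model `r₀` of the ORDERED residual diagonal of
`ρ₀`, ORIENTED ordinary of weight `(k, m) = (2, 1)` at every `v ∣ p`, unramified and good off the finite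
set `S = {v ∣ p} ∪ {q} ∪ {bad places of E}`, with the one-`q` level clause.  The proof is S7a's, verbatim
except at `v ∣ p`, where the prime `𝔓 ∣ v` of `\bar ℤ_F` receiving `I_{F_v}` now comes directly from
`Hida2000Thm326.exists_primesAbove_forall_inertia_absGaloisRestrict` and `e < p - 1`, `ω|_{I_v} ≠ 1` are read
off the hypothesis.  CONDITIONAL on the two classical theorems on elliptic curves over `p`-adic fields
`Literature.NumberTheory.EllipticCurves.ellipticOrdinaryReduction_tateModule_filtration` (Greenberg / Serre:
the ordinary line of `V_pE` at a place of good ORDINARY reduction) and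
`Literature.NumberTheory.EllipticCurves.ordinaryReduction_of_inertiaFixed_pTorsion` (Serre 1972 §1.11–1.12 /
Silverman VII.3.4: a non-zero inertia-fixed `p`-torsion point at a good place with `e < p - 1` forces
ordinary reduction), PREPENDED as hypotheses in this order, exactly as in S7a.
-/

set_option linter.dupNamespace false -- project-wide option (lakefile weak.linter.dupNamespace); `Summit.Langlands.Langlands` is the mandated namespace

noncomputable section

namespace Summit.Langlands.Langlands.Theorems.SkinnerWilesDefectOne.EisensteinProModularSeed

open Literature.NumberTheory.EllipticCurves Literature.NumberTheory.GaloisRepresentations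
open NumberField IsDedekindDomain IsLocalRing Field
open scoped MatrixGroups Matrix NumberField

set_option maxHeartbeats 400000 in
/-- **stub_cousinGaloisPackageWide** (line `descend-raise-basechange` v6, S7e — the Galois side of the
cousin graft for every prime `p`), CONDITIONAL on the two named facts
`ellipticOrdinaryReduction_tateModule_filtration → ordinaryReduction_of_inertiaFixed_pTorsion` prepended in
this order; statement = the registered stub of the line skeleton v6 in its short spelling (= S7a
`stub_cousinGaloisPackage` without `5 ≤ p`, with `e(v ∣ p) < p - 1` and `ω|_{I_v} ≠ 1` as hypotheses at
`v ∣ p`).  Proof (S7a's): an adapted `ℤ_p`-basis `(a, b)` of `T_pE` lifting `(P, Q)`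
(`Cousin.exists_adapted_pair`, `Cousin.exists_basis_of_pairMap_bijective`); `r = V_pE` framed in `1 ⊗ (a, b)`,
conjugate to `E.framedTateGaloisRep p` (`exists_conj_framedTateGaloisRep_eq_ofBasis`), with `p`-adically
integral entries (`Cousin.framedTateGaloisRepOfBasis_tensorBasis_apply`) whence `r₀`
(`exists_monoidHom_map_eq`), residually upper triangular with the ordered diagonal of `ρ₀`
(`Cousin.toZModPow_toMatrix_eq` and the cousin congruences); irreducible (`isIrreducible_conj`);
`S = {v ∣ p} ∪ {q} ∪ badPlaces E` (finite: `finite_setOf_natCast_mem`, `finite_badPlaces_holds`), off which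
`r` is unramified (`isUnramifiedAt_framedTateGaloisRep`, `isUnramifiedAt_conj_iff`) and `E` is good, with the
level clause by the good-reduction hypothesis; at `v ∣ p`: the prime `𝔓 ∣ v` receiving `I_{F_v}`
(`Hida2000Thm326.exists_primesAbove_forall_inertia_absGaloisRestrict`), ordinary reduction (fact 2, using the
hypothesis `e(v ∣ p) < p - 1`), the ordinary line (fact 1), and the oriented frame
(`Cousin.exists_oriented_frame`, using the hypothesis `ω|_{I_v} ≠ 1`). Skinner–Wiles (1999) §1;
Serre (1972) §1.11. [folklore] -/
theorem stub_cousinGaloisPackageWide :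
  Literature.NumberTheory.EllipticCurves.ellipticOrdinaryReduction_tateModule_filtration →
  Literature.NumberTheory.EllipticCurves.ordinaryReduction_of_inertiaFixed_pTorsion →
    ∀ (F : Type) [Field F] [NumberField F], NumberField.IsTotallyComplex F → Module.finrank ℚ F = 2 →
      ∀ (p : ℕ) [Fact p.Prime] (O : ValuationSubring (PadicAlgCl p)),
      O = (Valued.v : Valuation (PadicAlgCl p) NNReal).valuationSubring →
      ∀ (ρ₀ : absoluteGaloisGroup F →* Matrix.GeneralLinearGroup (Fin 2) O)
        (E : WeierstrassCurve F) [E.IsElliptic] (P Q : E.geomTorsion p) (q : HeightOneSpectrum (𝓞 F)),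
      P ≠ 0 → (∀ a : ℤ, Q ≠ a • P) →
      (∀ σ : absoluteGaloisGroup F, ∃ a b d : ℤ, σ • P = a • P ∧ σ • Q = b • P + d • Q ∧
          ((ρ₀ σ).val 0 0 - a : O) ∈ maximalIdeal O ∧ ((ρ₀ σ).val 1 1 - d : O) ∈ maximalIdeal O) →
      (∀ v : HeightOneSpectrum (𝓞 F), (p : 𝓞 F) ∈ v.asIdeal →
          (∀ 𝔓 ∈ v.primesAbove, ∀ σ ∈ 𝔓.inertia (absoluteGaloisGroup F), σ • P = P) ∧ E.HasGoodReductionAt v ∧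
          v.asIdeal.ramificationIdx ℤ < p - 1 ∧
          ∃ σ ∈ absInertia (v.adicCompletion F),
            PadicInt.toZModPow 1 ((GaloisRep.cyclotomicCharacter (v.adicCompletion F) p σ : ℤ_[p]ˣ) : ℤ_[p]) ≠ 1) →
      (∀ v : HeightOneSpectrum (𝓞 F), v ≠ q → (p : 𝓞 F) ∉ v.asIdeal →
          (∀ 𝔓 ∈ v.primesAbove, ∀ σ ∈ 𝔓.inertia (absoluteGaloisGroup F),
            ((ρ₀ σ).val 0 0 - 1 : O) ∈ maximalIdeal O ∧ ((ρ₀ σ).val 1 1 - 1 : O) ∈ maximalIdeal O) →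
          E.HasGoodReductionAt v) →
      (E.framedTateGaloisRep p).toGaloisRep.IsIrreducible →
      ∃ (r : FramedGaloisRep F (PadicAlgCl p) 2)
        (r₀ : absoluteGaloisGroup F →* Matrix.GeneralLinearGroup (Fin 2) O)
        (Pfr : Matrix.GeneralLinearGroup (Fin 2) (PadicAlgCl p)) (S : Set (HeightOneSpectrum (𝓞 F))),
        r = FramedRep.conj Pfr (E.framedTateGaloisRep p) ∧
        r.toGaloisRep.IsIrreducible ∧ r.HasUpperTriangularIntegralModel r₀ ∧
        (∀ g, ((r₀ g).val 0 0 - (ρ₀ g).val 0 0 : O) ∈ maximalIdeal O ∧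
          ((r₀ g).val 1 1 - (ρ₀ g).val 1 1 : O) ∈ maximalIdeal O) ∧
        (∃ k : ℕ, 2 ≤ k ∧ ∃ m : ℕ, 0 < m ∧ ∀ v : HeightOneSpectrum (𝓞 F), (p : 𝓞 F) ∈ v.asIdeal →
          ∃ Q : Matrix.GeneralLinearGroup (Fin 2) (PadicAlgCl p),
            Valued.v (Q.val 0 0) ≤ Valued.v (Q.val 1 0) ∧
            ∀ σ, (Q⁻¹ * r.toLocal v σ * Q).val 1 0 = 0 ∧
              (σ ∈ absInertia (v.adicCompletion F) →
                (Q⁻¹ * r.toLocal v σ * Q).val 1 1 ^ m = 1 ∧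
                (Q⁻¹ * r.toLocal v σ * Q).val 0 0 ^ m =
                  algebraMap (Padic p) (PadicAlgCl p)
                    (((GaloisRep.cyclotomicCharacter (v.adicCompletion F) p σ).val : PadicInt p) :
                      Padic p) ^ ((k - 1) * m))) ∧
        S.Finite ∧ (∀ v : HeightOneSpectrum (𝓞 F), (p : 𝓞 F) ∈ v.asIdeal → v ∈ S) ∧
        (∀ v ∉ S, r.IsUnramifiedAt v) ∧ (∀ v ∉ S, E.HasGoodReductionAt v) ∧
        (∀ v : HeightOneSpectrum (𝓞 F), v ≠ q → (p : 𝓞 F) ∉ v.asIdeal →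
          (∀ 𝔓 ∈ v.primesAbove, ∀ σ ∈ 𝔓.inertia (absoluteGaloisGroup F),
            ((ρ₀ σ).val 0 0 - 1 : O) ∈ maximalIdeal O ∧ ((ρ₀ σ).val 1 1 - 1 : O) ∈ maximalIdeal O) →
          v ∉ S) := by
  intro hOrd hFix F _ _ _ hF2 p hp O hO ρ₀ E _ P Q q hP0 hQP hgal hfix hgood hirr
  have hpr : p.Prime := hp.out
  -- Step 1: an adapted `ℤ_p`-basis of `T_p E`
  obtain ⟨a, b, ha, hb, hpair, hlev⟩ := Cousin.exists_adapted_pair E p hP0 hQP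
  obtain ⟨bT, hbT0, hbT1⟩ := Cousin.exists_basis_of_pairMap_bijective E p a b hpair
  have hinj : Function.Injective (TateModule.levelMap p a b 1) := (hlev 1).1
  set bV : Module.Basis (Fin 2) ℚ_[p] (E.rationalTateModule p) :=
    Algebra.TensorProduct.basis ℚ_[p] bT with hbVdef
  set r : FramedGaloisRep F (PadicAlgCl p) 2 :=
    E.framedTateGaloisRepOfBasis p (E.continuous_rationalGaloisRepTate_holds p) bV with hr
  obtain ⟨Pfr, hPfr⟩ :=
    E.exists_conj_framedTateGaloisRep_eq_ofBasis p (E.continuous_rationalGaloisRepTate_holds p) bV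
  have hrconj : r = FramedRep.conj Pfr (E.framedTateGaloisRep p) := hPfr.symm
  -- Step 2: the entries of `r` are `p`-adic integers
  set M : Field.absoluteGaloisGroup F → Matrix (Fin 2) (Fin 2) ℤ_[p] :=
    fun g => LinearMap.toMatrix bT bT (E.galoisRepTate p g) with hM
  have hent : ∀ g i j, (r g).val i j = algebraMap ℚ_[p] (PadicAlgCl p) ((M g i j : ℤ_[p]) : ℚ_[p]) :=
    fun g i j => Cousin.framedTateGaloisRepOfBasis_tensorBasis_apply E p bT g i j
  have hmem : ∀ g, r g ∈ (Matrix.GeneralLinearGroup.map (n := Fin 2) O.subtype).range := by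
    intro g
    rw [mem_range_generalLinearGroup_map_iff]
    refine ⟨fun i j => ?_, fun i j => ?_⟩
    · rw [hO, Valuation.mem_valuationSubring_iff]
      change Valued.v ((r g).val i j) ≤ 1
      rw [hent]
      exact Cousin.v_algebraMap_padicInt_le_one p _
    · rw [← map_inv, hO, Valuation.mem_valuationSubring_iff]
      change Valued.v ((r g⁻¹).val i j) ≤ 1
      rw [hent]
      exact Cousin.v_algebraMap_padicInt_le_one p _
  obtain ⟨r₀, hr₀⟩ := exists_monoidHom_map_eq r.toMonoidHom hmem
  have hentry : ∀ g i j, ((r₀ g).val i j : PadicAlgCl p) =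
      algebraMap ℚ_[p] (PadicAlgCl p) ((M g i j : ℤ_[p]) : ℚ_[p]) := by
    intro g i j
    rw [← hent]
    change _ = (r.toMonoidHom g).val i j
    rw [← hr₀ g]
    rfl
  -- Step 3: residual reading of the entries
  have hres : ∀ g, ∃ a₀ d₀ : ℤ,
      ((ρ₀ g).val 0 0 - a₀ : O) ∈ IsLocalRing.maximalIdeal O ∧
      ((ρ₀ g).val 1 1 - d₀ : O) ∈ IsLocalRing.maximalIdeal O ∧
      PadicInt.toZModPow 1 (M g 0 0) = a₀ ∧ PadicInt.toZModPow 1 (M g 1 0) = 0 ∧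
      PadicInt.toZModPow 1 (M g 1 1) = d₀ := by
    intro g
    obtain ⟨a₀, b₀, d₀, hgP, hgQ, hρa, hρd⟩ := hgal g
    have hgP' : g • TateModule.proj p 1 (bT 0) =
        a₀ • TateModule.proj p 1 a + (0 : ℤ) • TateModule.proj p 1 b := by
      rw [hbT0, ha, zero_zsmul, add_zero]
      have := congrArg Subtype.val hgP
      simpa using this
    have hgQ' : g • TateModule.proj p 1 (bT 1) =
        b₀ • TateModule.proj p 1 a + d₀ • TateModule.proj p 1 b := by
      rw [hbT1, ha, hb]
      have := congrArg Subtype.val hgQ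
      simpa using this
    obtain ⟨h00, h10⟩ := Cousin.toZModPow_toMatrix_eq E p hinj bT hbT0 hbT1 g 0 hgP'
    obtain ⟨-, h11⟩ := Cousin.toZModPow_toMatrix_eq E p hinj bT hbT0 hbT1 g 1 hgQ'
    exact ⟨a₀, d₀, hρa, hρd, h00, by simpa using h10, h11⟩
  -- congruences in `O`
  have hcong : ∀ (g : Field.absoluteGaloisGroup F) (i j : Fin 2) (x : ℤ),
      PadicInt.toZModPow 1 (M g i j) = x → ((r₀ g).val i j - x : O) ∈ IsLocalRing.maximalIdeal O := by
    intro g i j x hx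
    apply Summit.Langlands.Langlands.Theorems.EisensteinProModularSeed.Negative.mem_maximalIdeal_of_v_lt_one hO
    push_cast
    rw [hentry, ← map_intCast (algebraMap ℚ_[p] (PadicAlgCl p)), ← map_sub,
      ← PadicInt.coe_intCast, ← PadicInt.coe_sub]
    exact (Cousin.v_algebraMap_padicInt_lt_one_iff p _).mpr
      (Cousin.norm_sub_intCast_lt_one_of_toZModPow_eq p hx)
  have hmod : r.HasUpperTriangularIntegralModel r₀ := by
    refine ⟨fun g => hr₀ g, (isResiduallyUpperTriangular_two_iff r₀).mpr fun g => ?_⟩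
    obtain ⟨a₀, d₀, -, -, -, h10, -⟩ := hres g
    simpa using hcong g 1 0 0 (by simpa using h10)
  -- Step 4: the exceptional set
  set S : Set (HeightOneSpectrum (𝓞 F)) :=
    ({v | (p : 𝓞 F) ∈ v.asIdeal} ∪ {q}) ∪ E.badPlaces (𝓞 F) with hS
  refine ⟨r, r₀, Pfr, S, hrconj, ?_, hmod, ?_, ?_, ?_, ?_, ?_, ?_, ?_⟩
  · -- irreducible
    rw [hrconj]
    exact isIrreducible_conj _ Pfr hirr
  · -- ordered residual diagonal
    intro g
    obtain ⟨a₀, d₀, hρa, hρd, h00, -, h11⟩ := hres g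
    have e0 := Ideal.sub_mem _ (hcong g 0 0 a₀ h00) hρa
    have e1 := Ideal.sub_mem _ (hcong g 1 1 d₀ h11) hρd
    refine ⟨?_, ?_⟩
    · convert e0 using 1; ring
    · convert e1 using 1; ring
  · -- ORIENTED ordinarity of weight `(2, 1)` at `v ∣ p`
    refine ⟨2, le_rfl, 1, one_pos, fun v hpv => ?_⟩
    obtain ⟨hfixv, hgoodv, he, hω⟩ := hfix v hpv
    obtain ⟨𝔓, h𝔓, -, hinto⟩ :=
      Hida2000Thm326.exists_primesAbove_forall_inertia_absGaloisRestrict F v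
    have hord : ¬ ((p : ℤ) ∣ E.frobeniusTraceAt v) :=
      hFix E p v hpv hgoodv he 𝔓 h𝔓 P hP0 (hfixv 𝔓 h𝔓)
    obtain ⟨L, hL1, hstab, hchi, hquot⟩ := hOrd E p v hpv hgoodv hord
    have hfixa : ∀ σ ∈ 𝔓.inertia (absoluteGaloisGroup F),
        σ • TateModule.proj p 1 a = TateModule.proj p 1 a := by
      intro σ hσ
      rw [ha]
      have := congrArg Subtype.val (hfixv 𝔓 h𝔓 σ hσ)
      simpa using this
    exact Cousin.exists_oriented_frame p E hinj bT hbT0 hbT1 v hinto hω hfixa L hL1 hstab hchi hquot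
  · -- `S` is finite
    refine ((HeightOneSpectrum.finite_setOf_natCast_mem hpr.ne_zero).union
      (Set.finite_singleton q)).union (E.finite_badPlaces_holds (𝓞 F))
  · -- places above `p`
    intro v hv
    exact Or.inl (Or.inl hv)
  · -- unramified off `S`
    intro v hv
    simp only [hS, Set.mem_union, Set.mem_setOf_eq, Set.mem_singleton_iff, not_or,
      WeierstrassCurve.mem_badPlaces_iff, not_not] at hv
    rw [hrconj]
    exact (FramedGaloisRep.isUnramifiedAt_conj_iff v Pfr _).mpr
      (E.isUnramifiedAt_framedTateGaloisRep p hv.2 hv.1.1)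
  · -- good reduction off `S`
    intro v hv
    simp only [hS, Set.mem_union, Set.mem_setOf_eq, Set.mem_singleton_iff, not_or,
      WeierstrassCurve.mem_badPlaces_iff, not_not] at hv
    exact hv.2
  · -- the level clause
    intro v hvq hpv hunr hvS
    simp only [hS, Set.mem_union, Set.mem_setOf_eq, Set.mem_singleton_iff,
      WeierstrassCurve.mem_badPlaces_iff] at hvS
    rcases hvS with (h | h) | h
    · exact hpv h
    · exact hvq h
    · exact h (hgood v hvq hpv hunr)

end Summit.Langlands.Langlands.Theorems.SkinnerWilesDefectOne.EisensteinProModularSeed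

end
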